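import Literature.Topology.FourManifolds.LadderMorseFunction
import HarnessLib

/-!
# The core of the cut ladder: the planar Morse function `q₀ = q - c' + 4 Γ(y) Σ b(2(x - 4i - 2))`
# with `k + 1` minima and `k` saddles below `0`

Topic `Literature/Topology/FourManifolds`; brick E1-M(a) of the constructive road (P1′), route M,
to `Literature.Topology.FourManifolds.Trisection.isConnectedSum_of_reducing_separating`
(`ReducibleTrisectionSplitting.lean`, § Status), sequel of `LadderMorseFunction.lean`.

The ladder `q = P.ladder` (`LadderMorseFunction.lean`) presents a disc with `k` holes at the level
`c = P.level`, with straight product bridges `q = τx + (|y| - 1)²` on the slabs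
`|x - (4i + 2)| ≤ 1/2`, `κ/4 ≤ |y| ≤ 2`.  The **core function** of this file,

  `q₀(x, y) = q(x, y) - c' + 4 Γ(y) Σ_{i<k} b(2(x - 4i - 2))`     (`Ladder.Params.core`),

`c' = c - Δ⋆/4` (`coreLevel`, strictly between the rung-saddle values and `c`), `Γ` a smooth step
equal to `0` for `y ≤ -1/10` and to `1` for `y ≥ -1/20` (`cutoffY`), `b` the bump of
`LegendrianStabilisationModel.lean`, cuts the **upper** bridge of every slab: its sublevel set
`{q₀ ≤ 0}` is the `k`-holed disc `{q ≤ c'}` with the `k` upper bands removed — combinatorially a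
disc (the core of the handlebody), analytically a planar domain presented by a Morse function with
`k + 1` minima and `k` saddles below the level `0`:

* §1–§2: the slab sums, the cut-off, `q₀`, its differential (`hasFDerivAt_core`), the regions;
* §3 `isMCriticalPt_core_iff_mem`: **the critical points of `q₀`** are those of `q` (which lie off
  the slabs, where `q₀ = q - c'`) and, on the `i`-th slab, the four points
  `(4i + 2 - z/2, y)`, `z ∈ {z₁, z₂}` (the two roots of `b' = τ/8`, `exists_two_roots_dbump`),
  `y ∈ {0, 1}` — below the axis `∂q/∂y > 0` on a gap (`dY_pos_of_neg`) and `Γ' ≥ 0`, so the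
  transition band of `Γ` carries no critical point;
* §4: the Hessians there are diagonal (`fderiv_fderiv_separable`: near those points `q₀` is a
  separable function `φ(x) + ψ(y)`, `core_eq_upper`, `core_eq_axis`), with entries
  `16 b''(z)` and `2` resp. `2 - 8σ'(0)/κ < 0`; hence (`index_pocket`, `index_cutSaddle`,
  `index_axis₁`, `index_axis₂`) the **pockets** `(4i + 2 - z₁/2, 1)` are nondegenerate minima, the
  cut saddles `(4i + 2 - z₂/2, 1)` and the axis points `(4i + 2 - z₁/2, 0)` have index `1`, the
  axis points `(4i + 2 - z₂/2, 0)` index `2`; at the old points the Hessian is that of `q`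
  (`mhessian_core_eq_of_isMCriticalPt`); `isMorse_core`;
* §5–§6: values (`core_pocket_lt` `< 0`, `core_cutSaddle_pos`, `core_axis_pos`, `core_cap_lt`,
  `core_saddle_lt`, `core_max_pos`; numerics `level_gt' : 2/5 < c`, `bump_xStar_lt`), the
  seven-way classification `crit_core_cases`, and the counts below `0`:
  `ncard_criticalSetOfIndex_core_zero_inter = k + 1` (cap minimum and `k` pockets),
  `ncard_criticalSetOfIndex_core_one_inter = k` (rung saddles), all index-`2` points above `0`
  (`core_pos_of_index_two`), no critical value `0` (`isRegularLevel_core`), coercivity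
  (`norm_sq_le_core`), finiteness (`finite_criticalSet_core`).

The sequel thickens `q₀` to `ℝ⁴` (`ThickenedPlanarCore.lean`: `{q₀ + z² + w² ≤ 0}` is a compact
orientable `4`-manifold with boundary with `k + 1` `0`-handles and `k` `1`-handles; once it is
known to be connected it is a `4`-ball).  Everything is **proved**; definitions with bodies, no
named fact.

## References
* J. Milnor, *Lectures on the h-cobordism theorem* (1965), §8 (local alteration of Morse functions
  by bumps). [MilnorHCobordism1965]
* J. Milnor, *Morse theory* (1963), §§2–3. [Milnor1963]
* A. Juhász, *Differential and Low-Dimensional Topology* (2023), §3.5. [Juhasz2023]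
-/

noncomputable section

open scoped Topology ContDiff Manifold
open Set Filter Real
open Literature.Analysis.Pluripotential
open Literature.Geometry.Symplectic.LegendrianModel (bump dbump hasDerivAt_bump deriv_bump bump_pos
  bump_eq_zero bump_nonneg bump_le_bump_zero bump_lt_bump continuous_dbump dbump_eq_zero dbump_zero
  dbump_pos_of_neg dbump_neg_of_pos contDiff_bump continuous_bump bump_pos_iff bump_neg dbump_neg)

namespace Literature.Topology.FourManifolds

/-- Local notation: `𝔼 n` is the model Euclidean space `EuclideanSpace ℝ (Fin n)`. -/
local notation "𝔼 " n:arg => EuclideanSpace ℝ (Fin n)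

namespace Ladder

/-! ### §1 The slabs and the cut bumps -/

/-- Centre of the `i`-th slab (gap), `4i + 2`. [folklore] -/
def slabCtr (i : ℕ) : ℝ := 4 * i + 2

/-- The sum of the cut bumps `Σ_{i<k} b(2(x - slabCtr i))` (half-width `1/2`). [folklore] -/
def slabBump (k : ℕ) (x : ℝ) : ℝ := ∑ i ∈ Finset.range k, bump (2 * (x - slabCtr i))

/-- Its derivative `Σ_{i<k} 2 b'(2(x - slabCtr i))`. [folklore] -/
def slabDBump (k : ℕ) (x : ℝ) : ℝ := ∑ i ∈ Finset.range k, 2 * dbump (2 * (x - slabCtr i))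

/-- `b''` is even. [folklore] -/
theorem deriv_dbump_comp_neg (x : ℝ) : deriv dbump (-x) = deriv dbump x := by
  have h : (fun x => dbump (-x)) = fun x => -dbump x := funext dbump_neg
  have h1 : deriv (fun x => dbump (-x)) x = -deriv dbump (-x) := deriv_comp_neg dbump x
  rw [h, deriv.fun_neg] at h1
  linarith

/-- Two cut bumps of different slabs are never positive at the same point. [folklore] -/
theorem eq_of_slab_pos_of_slab_pos {x : ℝ} {i j : ℕ} (hi : 0 < bump (2 * (x - slabCtr i)))
    (hj : 0 < bump (2 * (x - slabCtr j))) : i = j := by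
  have h1 := abs_lt.1 (bump_pos_iff.1 hi)
  have h2 := abs_lt.1 (bump_pos_iff.1 hj)
  unfold slabCtr at h1 h2
  have h3 : |((i : ℝ)) - (j : ℝ)| < 1 := by rw [abs_lt]; constructor <;> linarith
  have h4 : |((i : ℤ) : ℝ) - ((j : ℤ) : ℝ)| < 1 := by simpa using h3
  rw [← Int.cast_sub, ← Int.cast_abs] at h4
  have h5 : |(i : ℤ) - j| < 1 := by exact_mod_cast h4
  have h6 : (i : ℤ) = j := by
    rcases abs_lt.1 h5 with ⟨h7, h8⟩
    omega
  exact_mod_cast h6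

/-- In the `i`-th slab only the `i`-th cut bump survives. [folklore] -/
theorem slabBump_eq_of_pos {k i : ℕ} (hi : i < k) {x : ℝ} (h : 0 < bump (2 * (x - slabCtr i))) :
    slabBump k x = bump (2 * (x - slabCtr i)) := by
  unfold slabBump
  rw [Finset.sum_eq_single_of_mem i (Finset.mem_range.2 hi)]
  intro j _ hji
  by_contra hne
  exact hji (eq_of_slab_pos_of_slab_pos (lt_of_le_of_ne (bump_nonneg _) (Ne.symm hne)) h)

/-- In the `i`-th slab only the `i`-th cut bump derivative survives. [folklore] -/
theorem slabDBump_eq_of_pos {k i : ℕ} (hi : i < k) {x : ℝ} (h : 0 < bump (2 * (x - slabCtr i))) :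
    slabDBump k x = 2 * dbump (2 * (x - slabCtr i)) := by
  unfold slabDBump
  rw [Finset.sum_eq_single_of_mem i (Finset.mem_range.2 hi)]
  intro j _ hji
  rw [dbump_eq_zero, mul_zero]
  by_contra hlt
  exact hji (eq_of_slab_pos_of_slab_pos (bump_pos (not_le.1 hlt)) h)

/-- In the `i`-th slab, as a function of `|x - slabCtr i| < 1/2`. [folklore] -/
theorem slabBump_eq_of_abs_lt {k i : ℕ} (hi : i < k) {x : ℝ} (hx : |x - slabCtr i| < 1 / 2) :
    slabBump k x = bump (2 * (x - slabCtr i)) :=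
  slabBump_eq_of_pos hi (bump_pos (by rw [abs_mul, abs_two]; linarith))

/-- In the `i`-th slab only the `i`-th cut bump derivative survives (abs form). [folklore] -/
theorem slabDBump_eq_of_abs_lt {k i : ℕ} (hi : i < k) {x : ℝ} (hx : |x - slabCtr i| < 1 / 2) :
    slabDBump k x = 2 * dbump (2 * (x - slabCtr i)) :=
  slabDBump_eq_of_pos hi (bump_pos (by rw [abs_mul, abs_two]; linarith))

/-- Off all slabs the cut bumps vanish. [folklore] -/
theorem slabBump_eq_zero {k : ℕ} {x : ℝ} (h : ∀ i < k, 1 / 2 ≤ |x - slabCtr i|) : slabBump k x = 0 :=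
  Finset.sum_eq_zero fun j hj => bump_eq_zero (by
    rw [abs_mul, abs_two]; linarith [h j (Finset.mem_range.1 hj)])

/-- Off all slabs the cut bump derivatives vanish. [folklore] -/
theorem slabDBump_eq_zero {k : ℕ} {x : ℝ} (h : ∀ i < k, 1 / 2 ≤ |x - slabCtr i|) : slabDBump k x = 0 :=
  Finset.sum_eq_zero fun j hj => by
    rw [dbump_eq_zero (by rw [abs_mul, abs_two]; linarith [h j (Finset.mem_range.1 hj)]), mul_zero]

/-- The sum of the cut bumps is smooth. [folklore] -/
theorem contDiff_slabBump (k : ℕ) : ContDiff ℝ ∞ (slabBump k) := by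
  unfold slabBump
  exact ContDiff.sum fun i _ => contDiff_bump.comp (contDiff_const.mul (contDiff_id.sub contDiff_const))

/-- `slabBump' = slabDBump`. [folklore] -/
theorem hasDerivAt_slabBump (k : ℕ) (x : ℝ) : HasDerivAt (slabBump k) (slabDBump k x) x := by
  unfold slabBump slabDBump
  refine HasDerivAt.fun_sum fun i _ => ?_
  have h1 := (hasDerivAt_bump (2 * (x - slabCtr i))).comp x
    (((hasDerivAt_id x).sub_const (slabCtr i)).const_mul 2)
  have e : dbump (2 * (x - slabCtr i)) * (2 * 1) = 2 * dbump (2 * (x - slabCtr i)) := by ring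
  rw [e] at h1
  exact h1

/-- The cut bumps are nonnegative. [folklore] -/
theorem slabBump_nonneg (k : ℕ) (x : ℝ) : 0 ≤ slabBump k x :=
  Finset.sum_nonneg fun _ _ => bump_nonneg _

/-- The cut bumps are at most `b(0) < 1/2`. [folklore] -/
theorem slabBump_le (k : ℕ) (x : ℝ) : slabBump k x ≤ bump 0 := by
  by_cases h : ∃ i < k, 0 < bump (2 * (x - slabCtr i))
  · obtain ⟨i, hi, hpos⟩ := h
    rw [slabBump_eq_of_pos hi hpos]
    exact bump_le_bump_zero _
  · push Not at h
    unfold slabBump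
    rw [Finset.sum_eq_zero fun j hj => le_antisymm (h j (Finset.mem_range.1 hj)) (bump_nonneg _)]
    exact bump_nonneg 0

/-! #### The slabs lie in the gaps -/

/-- A point of the `i`-th slab: `4i + 3/2 < x < 4i + 5/2`; it is at distance `≥ 3/2` from every
cell centre, and `1 < x < x_R`. [folklore] -/
theorem slab_mem {k i : ℕ} (hi : i < k) {x : ℝ} (hx : |x - slabCtr i| < 1 / 2) :
    1 < x ∧ x < xR k ∧ ∀ j < k, 1 ≤ |x - ctr j| := by
  have h := abs_lt.1 hx
  unfold slabCtr at h
  have hi0 : (0 : ℝ) ≤ i := Nat.cast_nonneg i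
  have hik : (i : ℝ) + 1 ≤ k := by exact_mod_cast hi
  refine ⟨by linarith, by unfold xR; linarith, fun j _ => ?_⟩
  unfold ctr
  rcases lt_or_ge j i with hji | hji
  · have : (j : ℝ) + 1 ≤ i := by exact_mod_cast hji
    rw [abs_of_nonneg (by linarith)]
    linarith
  · have : (i : ℝ) ≤ j := by exact_mod_cast hji
    rw [abs_of_neg (by linarith)]
    linarith

/-- On a slab the separation is `1`. [folklore] -/
theorem sFun_slab {k i : ℕ} (hi : i < k) {x : ℝ} (hx : |x - slabCtr i| < 1 / 2) : sFun k x = 1 := by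
  obtain ⟨h1, -, h3⟩ := slab_mem hi hx
  unfold sFun
  rw [smoothStep_of_ge zero_lt_one h1.le, uCell_eq_one h3, Real.sqrt_one, one_mul]

/-- A cell point `ctr j + ξ`, `|ξ| < 1`, is at distance `≥ 1/2` (indeed `≥ 1`) from every slab
centre. [folklore] -/
theorem half_le_abs_cell_sub_slabCtr {ξ : ℝ} (hξ : |ξ| < 1) (i j : ℕ) :
    1 / 2 ≤ |ctr j + ξ - slabCtr i| := by
  have h := abs_lt.1 hξ
  unfold ctr slabCtr
  rcases lt_or_ge j i with hji | hji
  · have : (j : ℝ) + 1 ≤ i := by exact_mod_cast hji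
    rw [abs_of_neg (by linarith)]; linarith
  · have : (i : ℝ) ≤ j := by exact_mod_cast hji
    rw [abs_of_pos (by linarith)]; linarith

/-! ### §2 The cut-off in `y`, the core function and its differential -/

/-- The cut-off `Γ(y) = smoothStep(-1/10, -1/20)(y)`: `0` for `y ≤ -1/10`, `1` for `y ≥ -1/20`.
[folklore] -/
def cutoffY (y : ℝ) : ℝ := smoothStep (-1 / 10) (-1 / 20) y

/-- `Γ = 0` for `y ≤ -1/10`. [folklore] -/
theorem cutoffY_of_le {y : ℝ} (hy : y ≤ -1 / 10) : cutoffY y = 0 := smoothStep_of_le (by norm_num) hy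
/-- `Γ = 1` for `y ≥ -1/20`. [folklore] -/
theorem cutoffY_of_ge {y : ℝ} (hy : -1 / 20 ≤ y) : cutoffY y = 1 := smoothStep_of_ge (by norm_num) hy
/-- `Γ ≥ 0`. [folklore] -/
theorem cutoffY_nonneg (y : ℝ) : 0 ≤ cutoffY y := (smoothStep_mem_Icc _ _ y).1
/-- `Γ ≤ 1`. [folklore] -/
theorem cutoffY_le_one (y : ℝ) : cutoffY y ≤ 1 := (smoothStep_mem_Icc _ _ y).2
/-- `Γ` is smooth. [folklore] -/
theorem contDiff_cutoffY : ContDiff ℝ ∞ cutoffY := contDiff_smoothStep _ _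
/-- `Γ' ≥ 0`. [folklore] -/
theorem deriv_cutoffY_nonneg (y : ℝ) : 0 ≤ deriv cutoffY y := deriv_smoothStep_nonneg (by norm_num) y
/-- `Γ' = 0` for `y ≤ -1/10`. [folklore] -/
theorem deriv_cutoffY_of_le {y : ℝ} (hy : y ≤ -1 / 10) : deriv cutoffY y = 0 := by
  rcases hy.eq_or_lt with h | h
  · rw [h]; exact deriv_smoothStep_left _ _
  · exact deriv_smoothStep_of_lt (by norm_num) h
/-- `Γ' = 0` for `y > -1/20`. [folklore] -/
theorem deriv_cutoffY_of_gt {y : ℝ} (hy : -1 / 20 < y) : deriv cutoffY y = 0 :=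
  deriv_smoothStep_of_gt (by norm_num) hy
/-- `Γ` has derivative `Γ'`. [folklore] -/
theorem hasDerivAt_cutoffY (y : ℝ) : HasDerivAt cutoffY (deriv cutoffY y) y :=
  (contDiff_cutoffY.differentiable (by simp) y).hasDerivAt

namespace Params

variable {k : ℕ} (P : Params k)

/-- On a slab the separation is flat: `s' = 0`. [folklore] -/
theorem sD_slab {i : ℕ} (hi : i < k) {x : ℝ} (hx : |x - slabCtr i| < 1 / 2) : sD k x = 0 := by
  unfold sD
  have hopen : {x : ℝ | |x - slabCtr i| < 1 / 2} ∈ 𝓝 x :=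
    (isOpen_lt (continuous_id.sub continuous_const).abs continuous_const).mem_nhds hx
  have : sFun k =ᶠ[𝓝 x] fun _ => 1 := eventuallyEq_of_mem hopen fun y hy => sFun_slab hi hy
  rw [this.deriv_eq, deriv_const]

/-- The critical points of the ladder lie off the slabs. [folklore] -/
theorem half_le_abs_sub_slabCtr_of_isMCriticalPt {p : 𝔼 2} (hp : IsMCriticalPt (𝓡 2) P.ladder p) (i : ℕ) :
    1 / 2 ≤ |p 0 - slabCtr i| := by
  have hi0 : (0 : ℝ) ≤ i := Nat.cast_nonneg i
  rcases (P.isMCriticalPt_iff_mem p).1 hp with h | ⟨j, -, h | h⟩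
  · rw [h, pt_apply_zero]; unfold slabCtr
    rw [abs_of_neg (by linarith [P.t₀_pos])]; linarith [P.t₀_pos]
  · rw [h, pt_apply_zero]; exact half_le_abs_cell_sub_slabCtr P.abs_x₁_lt i j
  · rw [h, pt_apply_zero]; exact half_le_abs_cell_sub_slabCtr P.abs_x₂_lt i j

/-- **The core level** `c' = c - Δ⋆/4` (between the rung saddle values and the ladder level).
[folklore] -/
def coreLevel : ℝ := P.level - gapStar / 4

/-- **The core function** `q₀(x, y) = q(x, y) - c' + 4 Γ(y) Σ_{i<k} b(2(x - 4i - 2))`: the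
ladder, shifted so that the level is `0`, with a big bump added on each upper bridge slab.
[folklore] -/
def coreFun (x y : ℝ) : ℝ := P.ladderFun x y - P.coreLevel + 4 * cutoffY y * slabBump k x

/-- The core function on `ℝ²`. [folklore] -/
def core (p : 𝔼 2) : ℝ := P.coreFun (p 0) (p 1)

/-- The core function is smooth. [folklore] -/
theorem contDiff_core : ContDiff ℝ ∞ P.core := by
  have h0 : ContDiff ℝ ∞ (fun p : 𝔼 2 => p 0) := contDiff_euclidean.1 contDiff_id 0
  have h1 : ContDiff ℝ ∞ (fun p : 𝔼 2 => p 1) := contDiff_euclidean.1 contDiff_id 1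
  have hl : ContDiff ℝ ∞ P.ladder := P.contDiff_ladder
  unfold core coreFun
  exact (hl.sub contDiff_const).add ((contDiff_const.mul (contDiff_cutoffY.comp h1)).mul
    ((contDiff_slabBump k).comp h0))

/-- `∂q₀/∂x = ∂q/∂x + 4 Γ(y) slabDBump(x)`. [folklore] -/
def cX (x y : ℝ) : ℝ := P.dX x y + 4 * cutoffY y * slabDBump k x

/-- `∂q₀/∂y = ∂q/∂y + 4 Γ'(y) slabBump(x)`. [folklore] -/
def cY (x y : ℝ) : ℝ := P.dY x y + 4 * deriv cutoffY y * slabBump k x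

/-- The differential of the core. [folklore] -/
def coreD (p : 𝔼 2) : 𝔼 2 →L[ℝ] ℝ := P.cX (p 0) (p 1) • X0 + P.cY (p 0) (p 1) • X1

/-- Evaluation of the differential of the core. [folklore] -/
@[simp] theorem coreD_apply (p v : 𝔼 2) :
    P.coreD p v = P.cX (p 0) (p 1) * v 0 + P.cY (p 0) (p 1) * v 1 := by
  simp [coreD]

/-- **The differential of the core.** [folklore] -/
theorem hasFDerivAt_core (p : 𝔼 2) : HasFDerivAt P.core (P.coreD p) p := by
  have hl := P.hasFDerivAt_ladder p
  have hΓ : HasFDerivAt (fun p : 𝔼 2 => cutoffY (p 1)) (deriv cutoffY (p 1) • X1) p :=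
    hasFDerivAt_comp_X1 (hasDerivAt_cutoffY (p 1))
  have hB : HasFDerivAt (fun p : 𝔼 2 => slabBump k (p 0)) (slabDBump k (p 0) • X0) p :=
    hasFDerivAt_comp_X0 (hasDerivAt_slabBump k (p 0))
  have hprod := (hΓ.mul hB).const_mul 4
  have hsum := (hl.sub_const P.coreLevel).add hprod
  have hfun : P.core = fun p : 𝔼 2 => P.ladder p - P.coreLevel + 4 * (cutoffY (p 1) * slabBump k (p 0)) := by
    funext p; unfold core coreFun ladder; ring
  rw [hfun]
  refine hsum.congr_fderiv ?_
  ext v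
  simp only [coreD_apply, cX, cY, ladderD_apply, _root_.add_apply, FunLike.coe_smul, Pi.smul_apply,
    X0_apply, X1_apply, smul_eq_mul]
  ring

/-- `fderiv q₀ = coreD`. [folklore] -/
theorem fderiv_core (p : 𝔼 2) : fderiv ℝ P.core p = P.coreD p := (P.hasFDerivAt_core p).fderiv

/-- Critical points of the core: `cX = 0 ∧ cY = 0`. [folklore] -/
theorem isMCriticalPt_core_iff (p : 𝔼 2) :
    IsMCriticalPt (𝓡 2) P.core p ↔ P.cX (p 0) (p 1) = 0 ∧ P.cY (p 0) (p 1) = 0 := by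
  rw [MorseBirth.isMCriticalPt_iff_fderiv, fderiv_core]
  constructor
  · intro h
    have e0 := congrArg (fun L : 𝔼 2 →L[ℝ] ℝ => L (EuclideanSpace.single 0 1)) h
    have e1 := congrArg (fun L : 𝔼 2 →L[ℝ] ℝ => L (EuclideanSpace.single 1 1)) h
    simp at e0 e1
    exact ⟨e0, e1⟩
  · rintro ⟨h0, h1⟩
    ext v
    simp [h0, h1]

/-! ### §3 The critical set of the core -/

/-- The two roots `z₁ < z₂` of `b' = τ/8` (`exists_two_roots_dbump`). [folklore] -/
theorem roots_spec' : ∃ z₁ z₂ : ℝ, z₁ ∈ Ioo (-1) (-xStar) ∧ z₂ ∈ Ioo (-1 / 2) 0 ∧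
    dbump z₁ = P.τ / 8 ∧ dbump z₂ = P.τ / 8 ∧ 0 < deriv dbump z₁ ∧ deriv dbump z₂ < 0 ∧
      ∀ x, dbump x = P.τ / 8 → x = z₁ ∨ x = z₂ :=
  exists_two_roots_dbump (by linarith [P.τ_pos]) (by linarith [P.τ_lt, P.τ_pos])

/-- Relative abscissa (times `-1/2`) of the pockets. [folklore] -/
def z₁ : ℝ := P.roots_spec'.choose

/-- Relative abscissa (times `-1/2`) of the cut saddles. [folklore] -/
def z₂ : ℝ := P.roots_spec'.choose_spec.choose

/-- `z₁ ∈ (-1, -x⋆)`. [folklore] -/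
theorem z₁_mem : P.z₁ ∈ Ioo (-1) (-xStar) := P.roots_spec'.choose_spec.choose_spec.1
/-- `z₂ ∈ (-1/2, 0)`. [folklore] -/
theorem z₂_mem : P.z₂ ∈ Ioo (-1 / 2) 0 := P.roots_spec'.choose_spec.choose_spec.2.1
/-- `b'(z₁) = τ/8`. [folklore] -/
theorem dbump_z₁ : dbump P.z₁ = P.τ / 8 := P.roots_spec'.choose_spec.choose_spec.2.2.1
/-- `b'(z₂) = τ/8`. [folklore] -/
theorem dbump_z₂ : dbump P.z₂ = P.τ / 8 := P.roots_spec'.choose_spec.choose_spec.2.2.2.1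
/-- `b''(z₁) > 0`. [folklore] -/
theorem deriv_dbump_z₁_pos : 0 < deriv dbump P.z₁ := P.roots_spec'.choose_spec.choose_spec.2.2.2.2.1
/-- `b''(z₂) < 0`. [folklore] -/
theorem deriv_dbump_z₂_neg : deriv dbump P.z₂ < 0 := P.roots_spec'.choose_spec.choose_spec.2.2.2.2.2.1
/-- `z₁, z₂` are the only roots of `b' = τ/8`. [folklore] -/
theorem eq_z₁_or_eq_z₂ {x : ℝ} (h : dbump x = P.τ / 8) : x = P.z₁ ∨ x = P.z₂ :=
  P.roots_spec'.choose_spec.choose_spec.2.2.2.2.2.2 x h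
/-- `|z₁| < 1`. [folklore] -/
theorem abs_z₁_lt : |P.z₁| < 1 := by
  have h := P.z₁_mem; rw [abs_lt]; exact ⟨h.1, by linarith [h.2, xStar_pos]⟩
/-- `|z₂| < 1`. [folklore] -/
theorem abs_z₂_lt : |P.z₂| < 1 := by
  have h := P.z₂_mem; rw [abs_lt]; exact ⟨by linarith [h.1], by linarith [h.2]⟩

/-- The abscissa `slabCtr i - z/2` lies in the `i`-th slab when `|z| < 1`. [folklore] -/
theorem abs_cut_sub_slabCtr {z : ℝ} (hz : |z| < 1) (i : ℕ) : |slabCtr i - z / 2 - slabCtr i| < 1 / 2 := by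
  rw [show slabCtr i - z / 2 - slabCtr i = -(z / 2) by ring, abs_neg, abs_div, abs_two]
  linarith

/-- `∂q/∂x = τ` on a slab. [folklore] -/
theorem dX_slab {i : ℕ} (hi : i < k) {x : ℝ} (hx : |x - slabCtr i| < 1 / 2) (y : ℝ) : P.dX x y = P.τ := by
  obtain ⟨h1, h2, -⟩ := slab_mem hi hx
  unfold dX
  rw [deriv_barrier_of_nonpos (by linarith : -x ≤ 0), deriv_barrier_of_nonpos (by linarith : x - xR k ≤ 0),
    sD_slab hi hx]
  ring

/-- `∂q₀/∂x = τ + 8 Γ(y) b'(2(x - slabCtr i))` on the `i`-th slab. [folklore] -/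
theorem cX_slab {i : ℕ} (hi : i < k) {x : ℝ} (hx : |x - slabCtr i| < 1 / 2) (y : ℝ) :
    P.cX x y = P.τ + 8 * cutoffY y * dbump (2 * (x - slabCtr i)) := by
  unfold cX; rw [P.dX_slab hi hx, slabDBump_eq_of_abs_lt hi hx]; ring

/-- `∂q₀/∂y = ∂q/∂y + 4 Γ'(y) b(2(x - slabCtr i))` on the `i`-th slab. [folklore] -/
theorem cY_slab {i : ℕ} (hi : i < k) {x : ℝ} (hx : |x - slabCtr i| < 1 / 2) (y : ℝ) :
    P.cY x y = P.dY x y + 4 * deriv cutoffY y * bump (2 * (x - slabCtr i)) := by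
  unfold cY; rw [slabBump_eq_of_abs_lt hi hx]

/-- **`∂q/∂y > 0` below the axis on a gap** (`s = 1`, `-1 < y < 0`). [folklore] -/
theorem dY_pos_of_neg {x y : ℝ} (hs : sFun k x = 1) (hy : y ∈ Ioo (-1 : ℝ) 0) : 0 < P.dY x y := by
  have hκ := P.κ_pos
  have hm := P.m₀_pos
  have hκm : P.κ < 4 * P.m₀ := by
    have h1 := P.κ_lt
    have h2 : 4 * (1 - 2 * bump 0) * P.m₀ ≤ 4 * P.m₀ := by nlinarith [bump_nonneg 0, uMin_pos]
    linarith
  rw [P.dY_of_abs_le (by rw [abs_of_neg hy.2]; linarith [hy.1]), hs]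
  set t := 4 * 1 * y / P.κ with ht
  have ht0 : t < 0 := by rw [ht]; exact div_neg_of_neg_of_pos (by linarith [hy.2]) hκ
  rcases le_or_gt t (-1) with h1 | h1
  · rw [smoothSign_of_le_neg_one h1]; linarith [hy.1]
  · have hσ : P.m₀ * (-t) ≤ smoothSign (-t) := P.m₀_slope (-t) ⟨by linarith, by linarith⟩
    rw [smoothSign_neg] at hσ
    have e : P.m₀ * (-t) = -(4 * P.m₀ / P.κ) * y := by rw [ht]; field_simp
    rw [e] at hσ
    have : 0 < -(4 * P.m₀ / P.κ) * y + y := by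
      have h3 : 1 < 4 * P.m₀ / P.κ := by rw [lt_div_iff₀ hκ]; linarith
      nlinarith [hy.2]
    nlinarith

/-- **`∂q/∂y < 0` just above the axis on a gap** (`s = 1`, `0 < y < κ/4`). [folklore] -/
theorem dY_neg_of_pos {x y : ℝ} (hs : sFun k x = 1) (hy : y ∈ Ioo (0 : ℝ) (P.κ / 4)) : P.dY x y < 0 := by
  have hκ := P.κ_pos
  have hm := P.m₀_pos
  have hκ4 := P.κ_le
  have hκm : P.κ < 4 * P.m₀ := by
    have h1 := P.κ_lt
    have h2 : 4 * (1 - 2 * bump 0) * P.m₀ ≤ 4 * P.m₀ := by nlinarith [bump_nonneg 0, uMin_pos]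
    linarith
  rw [P.dY_of_abs_le (by rw [abs_of_pos hy.1]; linarith [hy.2]), hs]
  set t := 4 * 1 * y / P.κ with ht
  have ht1 : t < 1 := by rw [ht, div_lt_one hκ]; linarith [hy.2]
  have ht0 : 0 < t := by rw [ht]; exact div_pos (by linarith [hy.1]) hκ
  have hσ : P.m₀ * t ≤ smoothSign t := P.m₀_slope t ⟨ht0.le, ht1.le⟩
  have e : P.m₀ * t = (4 * P.m₀ / P.κ) * y := by rw [ht]; field_simp
  rw [e] at hσ
  have h3 : 1 < 4 * P.m₀ / P.κ := by rw [lt_div_iff₀ hκ]; linarith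
  nlinarith [hy.1]

/-- `∂q/∂y = 2y - 2` on a gap for `κ/4 ≤ y ≤ 2`. [folklore] -/
theorem dY_upper {x y : ℝ} (hs : sFun k x = 1) (hy : y ∈ Icc (P.κ / 4) 2) : P.dY x y = 2 * y - 2 := by
  have hκ := P.κ_pos
  rw [P.dY_of_abs_le (by rw [abs_of_pos (by linarith [hy.1])]; exact hy.2), hs,
    smoothSign_of_one_le (by rw [le_div_iff₀ hκ]; linarith [hy.1])]
  ring

/-- **The critical points of the core.**  Besides the critical points of the ladder (which lie
off the slabs, where `q₀ = q - c'`), exactly the `4k` points `(slabCtr i - z/2, y)`,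
`z ∈ {z₁, z₂}`, `y ∈ {0, 1}`. [folklore] -/
theorem isMCriticalPt_core_iff_mem (p : 𝔼 2) :
    IsMCriticalPt (𝓡 2) P.core p ↔ IsMCriticalPt (𝓡 2) P.ladder p ∨
      ∃ i < k, ∃ z ∈ ({P.z₁, P.z₂} : Set ℝ), ∃ y ∈ ({0, 1} : Set ℝ), p = pt (slabCtr i - z / 2) y := by
  rw [P.isMCriticalPt_core_iff, P.isMCriticalPt_iff]
  constructor
  · rintro ⟨hX, hY⟩
    set x := p 0 with hxdef
    set y := p 1 with hydef
    by_cases hslab : ∃ i < k, |x - slabCtr i| < 1 / 2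
    · obtain ⟨i, hi, hx⟩ := hslab
      right
      have hs := sFun_slab hi hx
      rw [P.cX_slab hi hx] at hX
      rw [P.cY_slab hi hx] at hY
      have hτ := P.τ_pos
      have hκ := P.κ_pos
      -- `y > -1/10`: otherwise `cX = τ ≠ 0`
      have hy1 : -1 / 10 < y := by
        by_contra h
        rw [cutoffY_of_le (not_lt.1 h)] at hX
        linarith
      -- `y ≥ 0`: for `-1/10 < y < 0` one has `cY > 0`
      have hy2 : 0 ≤ y := by
        by_contra h
        have h1 := P.dY_pos_of_neg hs ⟨by linarith, not_le.1 h⟩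
        have h2 : 0 ≤ 4 * deriv cutoffY y * bump (2 * (x - slabCtr i)) :=
          mul_nonneg (mul_nonneg (by norm_num) (deriv_cutoffY_nonneg y)) (bump_nonneg _)
        linarith
      rw [cutoffY_of_ge (by linarith), mul_one] at hX
      rw [deriv_cutoffY_of_gt (by linarith), mul_zero, zero_mul, add_zero] at hY
      -- the abscissa
      have hdb : dbump (-(2 * (x - slabCtr i))) = P.τ / 8 := by rw [dbump_neg]; linarith
      have hxz : ∃ z ∈ ({P.z₁, P.z₂} : Set ℝ), x = slabCtr i - z / 2 := by
        rcases P.eq_z₁_or_eq_z₂ hdb with h | h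
        · exact ⟨P.z₁, by simp, by linarith⟩
        · exact ⟨P.z₂, by simp, by linarith⟩
      obtain ⟨z, hz, hxz⟩ := hxz
      -- the ordinate: `y = 0` or `y = 1`
      have hy01 : y = 0 ∨ y = 1 := by
        rcases hy2.eq_or_lt with h | h
        · exact Or.inl h.symm
        rcases lt_or_ge y (P.κ / 4) with h4 | h4
        · exact absurd hY (P.dY_neg_of_pos hs ⟨h, h4⟩).ne
        rcases le_or_gt y 2 with h5 | h5
        · rw [P.dY_upper hs ⟨h4, h5⟩] at hY
          exact Or.inr (by linarith)
        · exact absurd hY (P.dY_ne_zero_of_two_lt (by rw [abs_of_pos (by linarith)]; exact h5))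
      refine ⟨i, hi, z, hz, y, ?_, ?_⟩
      · rcases hy01 with h | h
        · rw [h]; simp
        · rw [h]; simp
      · rw [eq_pt_iff]; exact ⟨hxz, rfl⟩
    · -- off the slabs `q₀ = q - c'` to first order
      left
      push Not at hslab
      unfold cX at hX
      unfold cY at hY
      rw [slabDBump_eq_zero hslab, mul_zero, add_zero] at hX
      rw [slabBump_eq_zero hslab, mul_zero, add_zero] at hY
      exact ⟨hX, hY⟩
  · rintro (⟨hX, hY⟩ | ⟨i, hi, z, hz, y, hy, rfl⟩)
    · have hp : IsMCriticalPt (𝓡 2) P.ladder p := (P.isMCriticalPt_iff p).2 ⟨hX, hY⟩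
      have hoff := P.half_le_abs_sub_slabCtr_of_isMCriticalPt hp
      unfold cX cY
      rw [slabDBump_eq_zero fun i _ => hoff i, slabBump_eq_zero fun i _ => hoff i]
      simpa using And.intro hX hY
    · have hz1 : |z| < 1 := by
        rcases hz with rfl | rfl
        · exact P.abs_z₁_lt
        · exact P.abs_z₂_lt
      have hdbz : dbump z = P.τ / 8 := by
        rcases hz with rfl | rfl
        · exact P.dbump_z₁
        · exact P.dbump_z₂
      have hx := abs_cut_sub_slabCtr hz1 i
      have hs := sFun_slab hi hx
      simp only [pt_apply_zero, pt_apply_one]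
      rw [P.cX_slab hi hx, P.cY_slab hi hx]
      have e : 2 * (slabCtr i - z / 2 - slabCtr i) = -z := by ring
      rw [e, dbump_neg, hdbz]
      rcases hy with rfl | rfl
      · refine ⟨?_, ?_⟩
        · rw [cutoffY_of_ge (by norm_num)]; ring
        · rw [P.dY_axis, deriv_cutoffY_of_gt (by norm_num)]; ring
      · refine ⟨?_, ?_⟩
        · rw [cutoffY_of_ge (by norm_num)]; ring
        · have hκ4 := P.κ_le
          rw [P.dY_upper hs ⟨by linarith, by norm_num⟩, deriv_cutoffY_of_gt (by norm_num)]; ring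

/-! ### §4 Hessians -/

/-! #### Generic: diagonal Hessians of separable functions, index and nondegeneracy from a diagonal -/

omit P in
/-- **The Hessian of a separable function** `F(p) = φ(p₀) + ψ(p₁)` is `diag(φ'', ψ'')`. [folklore] -/
theorem fderiv_fderiv_separable {φ ψ : ℝ → ℝ} (hφ : ContDiff ℝ ∞ φ) (hψ : ContDiff ℝ ∞ ψ) (p v w : 𝔼 2) :
    fderiv ℝ (fderiv ℝ fun p : 𝔼 2 => φ (p 0) + ψ (p 1)) p v w =
      deriv (deriv φ) (p 0) * (v 0 * w 0) + deriv (deriv ψ) (p 1) * (v 1 * w 1) := by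
  have hφ1 : ∀ x, HasDerivAt φ (deriv φ x) x := fun x => (hφ.differentiable (by simp) x).hasDerivAt
  have hψ1 : ∀ x, HasDerivAt ψ (deriv ψ x) x := fun x => (hψ.differentiable (by simp) x).hasDerivAt
  have hφd : ContDiff ℝ ∞ (deriv φ) := (contDiff_infty_iff_deriv.1 hφ).2
  have hψd : ContDiff ℝ ∞ (deriv ψ) := (contDiff_infty_iff_deriv.1 hψ).2
  have hφ2 : ∀ x, HasDerivAt (deriv φ) (deriv (deriv φ) x) x := fun x =>
    (hφd.differentiable (by simp) x).hasDerivAt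
  have hψ2 : ∀ x, HasDerivAt (deriv ψ) (deriv (deriv ψ) x) x := fun x =>
    (hψd.differentiable (by simp) x).hasDerivAt
  -- first derivative, everywhere
  have h1 : ∀ q : 𝔼 2, HasFDerivAt (fun p : 𝔼 2 => φ (p 0) + ψ (p 1))
      (deriv φ (q 0) • X0 + deriv ψ (q 1) • X1) q := fun q =>
    (hasFDerivAt_comp_X0 (hφ1 (q 0))).add (hasFDerivAt_comp_X1 (hψ1 (q 1)))
  have hfd : fderiv ℝ (fun p : 𝔼 2 => φ (p 0) + ψ (p 1)) =
      fun q : 𝔼 2 => deriv φ (q 0) • X0 + deriv ψ (q 1) • X1 := funext fun q => (h1 q).fderiv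
  rw [hfd]
  -- second derivative
  have h2 : HasFDerivAt (fun q : 𝔼 2 => deriv φ (q 0) • X0 + deriv ψ (q 1) • X1)
      ((deriv (deriv φ) (p 0) • X0).smulRight X0 + (deriv (deriv ψ) (p 1) • X1).smulRight X1) p :=
    ((hasFDerivAt_comp_X0 (hφ2 (p 0))).smul_const X0).add ((hasFDerivAt_comp_X1 (hψ2 (p 1))).smul_const X1)
  rw [h2.fderiv]
  simp only [_root_.add_apply, ContinuousLinearMap.smulRight_apply, FunLike.coe_smul, Pi.smul_apply,
    X0_apply, X1_apply, smul_eq_mul]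
  ring

omit P in
/-- A bilinear form on `ℝ²` which is diagonal `diag(α, β)` is equivalent to that weighted sum of
squares. [folklore] -/
theorem equivalent_weightedSumSquares_of_diag {B : LinearMap.BilinForm ℝ (𝔼 2)} {α β : ℝ}
    (hB : ∀ v w, B v w = α * (v 0 * w 0) + β * (v 1 * w 1)) :
    QuadraticMap.Equivalent B.toQuadraticMap (QuadraticMap.weightedSumSquares ℝ ![α, β]) := by
  refine ⟨{ toLinearEquiv := (WithLp.linearEquiv 2 ℝ (Fin 2 → ℝ)), map_app' := fun v => ?_ }⟩
  rw [QuadraticMap.weightedSumSquares_apply, LinearMap.BilinMap.toQuadraticMap_apply, hB]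
  simp [Fin.sum_univ_two, smul_eq_mul]

omit P in
/-- **Morse index from a diagonal Hessian** on `ℝ²`. [folklore] -/
theorem morseIndex_of_diag {f : 𝔼 2 → ℝ} {p : 𝔼 2} {α β : ℝ}
    (hB : ∀ v w, mhessian (𝓡 2) f p v w = α * (v 0 * w 0) + β * (v 1 * w 1)) :
    morseIndex (𝓡 2) f p = {i : Fin 2 | (![α, β] : Fin 2 → ℝ) i < 0}.ncard := by
  unfold morseIndex
  exact QuadraticForm.sigNeg_of_equiv_weightedSumSquares (equivalent_weightedSumSquares_of_diag hB)

omit P in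
/-- Index `0` for a positive diagonal. [folklore] -/
theorem morseIndex_of_diag_pos_pos {f : 𝔼 2 → ℝ} {p : 𝔼 2} {α β : ℝ} (hα : 0 < α) (hβ : 0 < β)
    (hB : ∀ v w, mhessian (𝓡 2) f p v w = α * (v 0 * w 0) + β * (v 1 * w 1)) :
    morseIndex (𝓡 2) f p = 0 := by
  rw [morseIndex_of_diag hB]
  have : {i : Fin 2 | (![α, β] : Fin 2 → ℝ) i < 0} = ∅ := by
    ext j; fin_cases j
    · simp; linarith
    · simp; linarith
  rw [this, Set.ncard_empty]

omit P in
/-- Index `1` for a diagonal of signs `(-, +)`. [folklore] -/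
theorem morseIndex_of_diag_neg_pos {f : 𝔼 2 → ℝ} {p : 𝔼 2} {α β : ℝ} (hα : α < 0) (hβ : 0 < β)
    (hB : ∀ v w, mhessian (𝓡 2) f p v w = α * (v 0 * w 0) + β * (v 1 * w 1)) :
    morseIndex (𝓡 2) f p = 1 := by
  rw [morseIndex_of_diag hB]
  have : {i : Fin 2 | (![α, β] : Fin 2 → ℝ) i < 0} = {0} := by
    ext j; fin_cases j
    · simp [hα]
    · simp; linarith
  rw [this, Set.ncard_singleton]

omit P in
/-- Index `1` for a diagonal of signs `(+, -)`. [folklore] -/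
theorem morseIndex_of_diag_pos_neg {f : 𝔼 2 → ℝ} {p : 𝔼 2} {α β : ℝ} (hα : 0 < α) (hβ : β < 0)
    (hB : ∀ v w, mhessian (𝓡 2) f p v w = α * (v 0 * w 0) + β * (v 1 * w 1)) :
    morseIndex (𝓡 2) f p = 1 := by
  rw [morseIndex_of_diag hB]
  have : {i : Fin 2 | (![α, β] : Fin 2 → ℝ) i < 0} = {1} := by
    ext j; fin_cases j
    · simp; linarith
    · simp [hβ]
  rw [this, Set.ncard_singleton]

omit P in
/-- Index `2` for a negative diagonal. [folklore] -/
theorem morseIndex_of_diag_neg_neg {f : 𝔼 2 → ℝ} {p : 𝔼 2} {α β : ℝ} (hα : α < 0) (hβ : β < 0)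
    (hB : ∀ v w, mhessian (𝓡 2) f p v w = α * (v 0 * w 0) + β * (v 1 * w 1)) :
    morseIndex (𝓡 2) f p = 2 := by
  rw [morseIndex_of_diag hB]
  have : {i : Fin 2 | (![α, β] : Fin 2 → ℝ) i < 0} = Set.univ := by
    ext j; fin_cases j <;> simp [hα, hβ]
  rw [this, Set.ncard_univ, Nat.card_eq_fintype_card, Fintype.card_fin]

omit P in
/-- **Hessians agree for functions which agree near the point.** [folklore] -/
theorem mhessian_congr_of_eventuallyEq {f g : 𝔼 2 → ℝ} {p : 𝔼 2} (h : f =ᶠ[𝓝 p] g) (v w : 𝔼 2) :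
    mhessian (𝓡 2) f p v w = mhessian (𝓡 2) g p v w := by
  rw [MorseBirth.mhessian_model_apply, MorseBirth.mhessian_model_apply, (h.fderiv).fderiv_eq]

omit P in
/-- Hessians agree as bilinear forms for functions which agree near the point. [folklore] -/
theorem mhessian_eq_of_eventuallyEq {f g : 𝔼 2 → ℝ} {p : 𝔼 2} (h : f =ᶠ[𝓝 p] g) :
    mhessian (𝓡 2) f p = mhessian (𝓡 2) g p := by
  ext v w; exact mhessian_congr_of_eventuallyEq h v w

omit P in
/-- The Morse index agrees for functions which agree near the point. [folklore] -/
theorem morseIndex_congr_of_eventuallyEq {f g : 𝔼 2 → ℝ} {p : 𝔼 2} (h : f =ᶠ[𝓝 p] g) :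
    morseIndex (𝓡 2) f p = morseIndex (𝓡 2) g p := by
  unfold morseIndex; rw [mhessian_eq_of_eventuallyEq h]

/-! #### The local forms of the core near the new critical points -/

/-- The `x`-profile on the `i`-th slab: `φ(x) = τ x + 4 b(2(x - slabCtr i)) + C`. [folklore] -/
def xProfile (i : ℕ) (C x : ℝ) : ℝ := P.τ * x + 4 * bump (2 * (x - slabCtr i)) + C

omit P in
/-- The `y`-profile near the axis: `ψ₀(y) = y² - (κ/2) S(4y/κ)`. [folklore] -/
def yProfile₀ (κ y : ℝ) : ℝ := y ^ 2 - κ / 2 * smoothAbs (4 * y / κ)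

/-- The `x`-profile is smooth. [folklore] -/
theorem contDiff_xProfile (i : ℕ) (C : ℝ) : ContDiff ℝ ∞ (P.xProfile i C) := by
  unfold xProfile
  exact ((contDiff_const.mul contDiff_id).add (contDiff_const.mul (contDiff_bump.comp
    (contDiff_const.mul (contDiff_id.sub contDiff_const))))).add contDiff_const

omit P in
/-- The `y`-profile is smooth. [folklore] -/
theorem contDiff_yProfile₀ (κ : ℝ) : ContDiff ℝ ∞ (yProfile₀ κ) := by
  unfold yProfile₀
  exact (contDiff_id.pow 2).sub (contDiff_const.mul (contDiff_smoothAbs.comp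
    ((contDiff_const.mul contDiff_id).div_const _)))

/-- `φ' = τ + 8 b'(2(x - slabCtr i))`. [folklore] -/
theorem hasDerivAt_xProfile (i : ℕ) (C x : ℝ) :
    HasDerivAt (P.xProfile i C) (P.τ + 8 * dbump (2 * (x - slabCtr i))) x := by
  unfold xProfile
  have h1 := (hasDerivAt_bump (2 * (x - slabCtr i))).comp x
    (((hasDerivAt_id x).sub_const (slabCtr i)).const_mul 2)
  have h2 : HasDerivAt (fun x => P.τ * x + 4 * bump (2 * (x - slabCtr i)) + C)
      (P.τ * 1 + 4 * (dbump (2 * (x - slabCtr i)) * (2 * 1))) x :=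
    (((hasDerivAt_id x).const_mul P.τ).add (h1.const_mul 4)).add_const C
  have e : P.τ + 8 * dbump (2 * (x - slabCtr i)) = P.τ * 1 + 4 * (dbump (2 * (x - slabCtr i)) * (2 * 1)) := by
    ring
  rw [e]; exact h2

/-- `φ'` as a `deriv`. [folklore] -/
theorem deriv_xProfile (i : ℕ) (C x : ℝ) : deriv (P.xProfile i C) x = P.τ + 8 * dbump (2 * (x - slabCtr i)) :=
  (P.hasDerivAt_xProfile i C x).deriv

/-- `φ'' = 16 b''(2(x - slabCtr i))`. [folklore] -/
theorem deriv_deriv_xProfile (i : ℕ) (C x : ℝ) :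
    deriv (deriv (P.xProfile i C)) x = 16 * deriv dbump (2 * (x - slabCtr i)) := by
  have hfun : deriv (P.xProfile i C) = fun x => P.τ + 8 * dbump (2 * (x - slabCtr i)) :=
    funext fun x => P.deriv_xProfile i C x
  rw [hfun]
  have h1 := (hasDerivAt_dbump' (2 * (x - slabCtr i))).comp x
    (((hasDerivAt_id x).sub_const (slabCtr i)).const_mul 2)
  have h2 : HasDerivAt (fun x => P.τ + 8 * dbump (2 * (x - slabCtr i)))
      (8 * (deriv dbump (2 * (x - slabCtr i)) * (2 * 1))) x := (h1.const_mul 8).const_add P.τ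
  rw [h2.deriv]; ring

omit P in
/-- `ψ₀' = 2y - 2σ(4y/κ)`. [folklore] -/
theorem hasDerivAt_yProfile₀ {κ : ℝ} (hκ : κ ≠ 0) (y : ℝ) :
    HasDerivAt (yProfile₀ κ) (2 * y - 2 * smoothSign (4 * y / κ)) y := by
  unfold yProfile₀
  have h1 : HasDerivAt (fun y : ℝ => 4 * y / κ) (4 / κ) y := by
    have := ((hasDerivAt_id y).const_mul 4).div_const κ
    simpa using this
  have h2 := ((hasDerivAt_smoothAbs _).comp y h1).const_mul (κ / 2)
  have h3 : HasDerivAt (fun y => y ^ 2 - κ / 2 * smoothAbs (4 * y / κ))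
      (↑(2 : ℕ) * y ^ (2 - 1) - κ / 2 * (smoothSign (4 * y / κ) * (4 / κ))) y :=
    (hasDerivAt_pow 2 y).sub h2
  have e : 2 * y - 2 * smoothSign (4 * y / κ) =
      ↑(2 : ℕ) * y ^ (2 - 1) - κ / 2 * (smoothSign (4 * y / κ) * (4 / κ)) := by
    field_simp
    ring
  rw [e]
  exact h3

omit P in
/-- `ψ₀'' = 2 - 8 σ'(4y/κ)/κ`. [folklore] -/
theorem deriv_deriv_yProfile₀ {κ : ℝ} (hκ : κ ≠ 0) (y : ℝ) :
    deriv (deriv (yProfile₀ κ)) y = 2 - 8 * deriv smoothSign (4 * y / κ) / κ := by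
  have hfun : deriv (yProfile₀ κ) = fun y => 2 * y - 2 * smoothSign (4 * y / κ) :=
    funext fun y => (hasDerivAt_yProfile₀ hκ y).deriv
  rw [hfun]
  have h1 : HasDerivAt (fun y : ℝ => 4 * y / κ) (4 / κ) y := by
    have := ((hasDerivAt_id y).const_mul 4).div_const κ
    simpa using this
  have h2 := (((hasDerivAt_smoothSign _).comp y h1).const_mul 2)
  have h3 : HasDerivAt (fun y => 2 * y - 2 * smoothSign (4 * y / κ))
      (2 * 1 - 2 * (deriv smoothSign (4 * y / κ) * (4 / κ))) y := ((hasDerivAt_id y).const_mul 2).sub h2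
  rw [h3.deriv]
  field_simp
  ring

/-- **Local form near the upper bridge points**: on the open set
`{|x - slabCtr i| < 1/2, κ/4 < y < 2}` the core is `φ(x) + (y - 1)²` with `C = -c'`. [folklore] -/
theorem core_eq_upper {i : ℕ} (hi : i < k) {p : 𝔼 2} (hx : |p 0 - slabCtr i| < 1 / 2)
    (hy : p 1 ∈ Ioo (P.κ / 4) 2) :
    P.core p = P.xProfile i (-P.coreLevel) (p 0) + (p 1 - 1) ^ 2 := by
  have hκ := P.κ_pos
  have hbr := P.ladder_eq_bridge hi (x := p 0) (y := p 1) (by unfold slabCtr at hx; exact hx.le)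
    (by rw [abs_of_pos (by linarith [hy.1])]; exact hy.1.le) (by rw [abs_of_pos (by linarith [hy.1])]; exact hy.2.le)
  rw [pt_eta] at hbr
  unfold core coreFun xProfile
  have hl : P.ladderFun (p 0) (p 1) = P.ladder p := rfl
  rw [hl, hbr, cutoffY_of_ge (by linarith [hy.1]), slabBump_eq_of_abs_lt hi hx,
    abs_of_pos (by linarith [hy.1] : (0:ℝ) < p 1)]
  ring

/-- **Local form near the axis points**: on `{|x - slabCtr i| < 1/2, |y| < 1/20}` the core is
`φ(x) + ψ₀(y)` with `C = 1 - c'`. [folklore] -/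
theorem core_eq_axis {i : ℕ} (hi : i < k) {p : 𝔼 2} (hx : |p 0 - slabCtr i| < 1 / 2)
    (hy : |p 1| < 1 / 20) :
    P.core p = P.xProfile i (1 - P.coreLevel) (p 0) + yProfile₀ P.κ (p 1) := by
  obtain ⟨h1, h2, -⟩ := slab_mem hi hx
  have hs := sFun_slab hi hx
  have hyy := abs_lt.1 hy
  unfold core coreFun xProfile yProfile₀ ladderFun
  rw [hs, barrier_of_nonpos (by linarith : -(p 0) ≤ 0), barrier_of_nonpos (by linarith : p 0 - xR k ≤ 0),
    barrier_of_nonpos (by linarith : p 1 - 2 ≤ 0), barrier_of_nonpos (by linarith : -(p 1) - 2 ≤ 0),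
    cutoffY_of_ge (by linarith), slabBump_eq_of_abs_lt hi hx]
  ring

/-- The Hessian of the core at an upper bridge point of the `i`-th slab. [folklore] -/
theorem mhessian_core_upper {i : ℕ} (hi : i < k) {p : 𝔼 2} (hx : |p 0 - slabCtr i| < 1 / 2)
    (hy : p 1 ∈ Ioo (P.κ / 4) 2) (v w : 𝔼 2) :
    mhessian (𝓡 2) P.core p v w =
      16 * deriv dbump (2 * (p 0 - slabCtr i)) * (v 0 * w 0) + 2 * (v 1 * w 1) := by
  have hopen : {q : 𝔼 2 | |q 0 - slabCtr i| < 1 / 2 ∧ q 1 ∈ Ioo (P.κ / 4) 2} ∈ 𝓝 p := by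
    have hc0 : Continuous fun q : 𝔼 2 => q 0 := (EuclideanSpace.proj (0 : Fin 2)).continuous
    have hc1 : Continuous fun q : 𝔼 2 => q 1 := (EuclideanSpace.proj (1 : Fin 2)).continuous
    exact ((isOpen_lt (hc0.sub continuous_const).abs continuous_const).inter
      (isOpen_Ioo.preimage hc1)).mem_nhds ⟨hx, hy⟩
  have hev : P.core =ᶠ[𝓝 p] fun q : 𝔼 2 => P.xProfile i (-P.coreLevel) (q 0) + (fun y : ℝ => (y - 1) ^ 2) (q 1) :=
    eventuallyEq_of_mem hopen fun q hq => P.core_eq_upper hi hq.1 hq.2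
  have hψ : ContDiff ℝ ∞ (fun y : ℝ => (y - 1) ^ 2) := (contDiff_id.sub contDiff_const).pow 2
  rw [mhessian_congr_of_eventuallyEq hev, MorseBirth.mhessian_model_apply,
    fderiv_fderiv_separable (ψ := fun y : ℝ => (y - 1) ^ 2) (P.contDiff_xProfile i _) hψ,
    P.deriv_deriv_xProfile]
  have h2 : deriv (deriv fun y : ℝ => (y - 1) ^ 2) (p 1) = 2 := by
    have hd : deriv (fun y : ℝ => (y - 1) ^ 2) = fun y => 2 * (y - 1) := by
      funext y
      have h : HasDerivAt (fun y : ℝ => (y - 1) ^ 2) (↑(2 : ℕ) * (y - 1) ^ (2 - 1) * 1) y :=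
        ((hasDerivAt_id y).sub_const 1).pow 2
      rw [h.deriv]; norm_num
    rw [hd]
    have h : HasDerivAt (fun y : ℝ => 2 * (y - 1)) (2 * 1) (p 1) := ((hasDerivAt_id (p 1)).sub_const 1).const_mul 2
    rw [h.deriv]; ring
  rw [h2]

/-- The Hessian of the core at an axis point of the `i`-th slab. [folklore] -/
theorem mhessian_core_axis {i : ℕ} (hi : i < k) {p : 𝔼 2} (hx : |p 0 - slabCtr i| < 1 / 2)
    (hy : |p 1| < 1 / 20) (v w : 𝔼 2) :
    mhessian (𝓡 2) P.core p v w =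
      16 * deriv dbump (2 * (p 0 - slabCtr i)) * (v 0 * w 0) +
        (2 - 8 * deriv smoothSign (4 * p 1 / P.κ) / P.κ) * (v 1 * w 1) := by
  have hopen : {q : 𝔼 2 | |q 0 - slabCtr i| < 1 / 2 ∧ |q 1| < 1 / 20} ∈ 𝓝 p := by
    have hc0 : Continuous fun q : 𝔼 2 => q 0 := (EuclideanSpace.proj (0 : Fin 2)).continuous
    have hc1 : Continuous fun q : 𝔼 2 => q 1 := (EuclideanSpace.proj (1 : Fin 2)).continuous
    exact ((isOpen_lt (hc0.sub continuous_const).abs continuous_const).inter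
      (isOpen_lt hc1.abs continuous_const)).mem_nhds ⟨hx, hy⟩
  have hev : P.core =ᶠ[𝓝 p] fun q : 𝔼 2 => P.xProfile i (1 - P.coreLevel) (q 0) + yProfile₀ P.κ (q 1) :=
    eventuallyEq_of_mem hopen fun q hq => P.core_eq_axis hi hq.1 hq.2
  rw [mhessian_congr_of_eventuallyEq hev, MorseBirth.mhessian_model_apply,
    fderiv_fderiv_separable (P.contDiff_xProfile i _) (contDiff_yProfile₀ P.κ),
    P.deriv_deriv_xProfile, deriv_deriv_yProfile₀ P.κ_pos.ne']

/-- `2 - 8 σ'(0)/κ < 0`. [folklore] -/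
theorem two_sub_lt_zero : 2 - 8 * deriv smoothSign 0 / P.κ < 0 := by
  have hκ := P.κ_pos
  have hm := P.m₀_le
  have hm0 := P.m₀_pos
  have hκm : P.κ < 4 * P.m₀ := by
    have h1 := P.κ_lt
    have h2 : 4 * (1 - 2 * bump 0) * P.m₀ ≤ 4 * P.m₀ := by nlinarith [bump_nonneg 0, uMin_pos]
    linarith
  rw [sub_neg, lt_div_iff₀ hκ]
  nlinarith

/-! #### Nondegeneracy and indices at the new points -/

/-- The pocket `(slabCtr i - z₁/2, 1)`: nondegenerate minimum. [folklore] -/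
theorem index_pocket {i : ℕ} (hi : i < k) :
    (mhessian (𝓡 2) P.core (pt (slabCtr i - P.z₁ / 2) 1)).Nondegenerate ∧
      morseIndex (𝓡 2) P.core (pt (slabCtr i - P.z₁ / 2) 1) = 0 := by
  have hκ4 := P.κ_le
  have hx := abs_cut_sub_slabCtr P.abs_z₁_lt i
  have hB := P.mhessian_core_upper hi (p := pt (slabCtr i - P.z₁ / 2) 1) (by simpa using hx)
    (by simp only [pt_apply_one]; exact ⟨by linarith, by norm_num⟩)
  simp only [pt_apply_zero, show 2 * (slabCtr i - P.z₁ / 2 - slabCtr i) = -P.z₁ by ring,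
    deriv_dbump_comp_neg] at hB
  have hpos : 0 < 16 * deriv dbump P.z₁ := by linarith [P.deriv_dbump_z₁_pos]
  exact ⟨FlowerModel.nondegenerate_of_diag₂ hpos.ne' two_ne_zero hB, morseIndex_of_diag_pos_pos hpos two_pos hB⟩

/-- The cut saddle `(slabCtr i - z₂/2, 1)`: nondegenerate of index `1`. [folklore] -/
theorem index_cutSaddle {i : ℕ} (hi : i < k) :
    (mhessian (𝓡 2) P.core (pt (slabCtr i - P.z₂ / 2) 1)).Nondegenerate ∧
      morseIndex (𝓡 2) P.core (pt (slabCtr i - P.z₂ / 2) 1) = 1 := by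
  have hκ4 := P.κ_le
  have hx := abs_cut_sub_slabCtr P.abs_z₂_lt i
  have hB := P.mhessian_core_upper hi (p := pt (slabCtr i - P.z₂ / 2) 1) (by simpa using hx)
    (by simp only [pt_apply_one]; exact ⟨by linarith, by norm_num⟩)
  simp only [pt_apply_zero, show 2 * (slabCtr i - P.z₂ / 2 - slabCtr i) = -P.z₂ by ring,
    deriv_dbump_comp_neg] at hB
  have hneg : 16 * deriv dbump P.z₂ < 0 := by linarith [P.deriv_dbump_z₂_neg]
  exact ⟨FlowerModel.nondegenerate_of_diag₂ hneg.ne two_ne_zero hB, morseIndex_of_diag_neg_pos hneg two_pos hB⟩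

/-- The axis point `(slabCtr i - z₁/2, 0)`: nondegenerate of index `1`. [folklore] -/
theorem index_axis₁ {i : ℕ} (hi : i < k) :
    (mhessian (𝓡 2) P.core (pt (slabCtr i - P.z₁ / 2) 0)).Nondegenerate ∧
      morseIndex (𝓡 2) P.core (pt (slabCtr i - P.z₁ / 2) 0) = 1 := by
  have hx := abs_cut_sub_slabCtr P.abs_z₁_lt i
  have hB := P.mhessian_core_axis hi (p := pt (slabCtr i - P.z₁ / 2) 0) (by simpa using hx)
    (by simp only [pt_apply_one, abs_zero]; norm_num)
  simp only [pt_apply_zero, pt_apply_one, show 2 * (slabCtr i - P.z₁ / 2 - slabCtr i) = -P.z₁ by ring,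
    deriv_dbump_comp_neg, mul_zero, zero_div] at hB
  have hpos : 0 < 16 * deriv dbump P.z₁ := by linarith [P.deriv_dbump_z₁_pos]
  have hneg := P.two_sub_lt_zero
  exact ⟨FlowerModel.nondegenerate_of_diag₂ hpos.ne' hneg.ne hB, morseIndex_of_diag_pos_neg hpos hneg hB⟩

/-- The axis point `(slabCtr i - z₂/2, 0)`: nondegenerate of index `2`. [folklore] -/
theorem index_axis₂ {i : ℕ} (hi : i < k) :
    (mhessian (𝓡 2) P.core (pt (slabCtr i - P.z₂ / 2) 0)).Nondegenerate ∧
      morseIndex (𝓡 2) P.core (pt (slabCtr i - P.z₂ / 2) 0) = 2 := by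
  have hx := abs_cut_sub_slabCtr P.abs_z₂_lt i
  have hB := P.mhessian_core_axis hi (p := pt (slabCtr i - P.z₂ / 2) 0) (by simpa using hx)
    (by simp only [pt_apply_one, abs_zero]; norm_num)
  simp only [pt_apply_zero, pt_apply_one, show 2 * (slabCtr i - P.z₂ / 2 - slabCtr i) = -P.z₂ by ring,
    deriv_dbump_comp_neg, mul_zero, zero_div] at hB
  have hneg : 16 * deriv dbump P.z₂ < 0 := by linarith [P.deriv_dbump_z₂_neg]
  have hneg' := P.two_sub_lt_zero
  exact ⟨FlowerModel.nondegenerate_of_diag₂ hneg.ne hneg'.ne hB, morseIndex_of_diag_neg_neg hneg hneg' hB⟩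

/-! #### The old points: the core is the shifted ladder near them -/

/-- Off the closed slabs the core is the shifted ladder. [folklore] -/
theorem core_eq_ladder_of_off {p : 𝔼 2} (h : ∀ i < k, 1 / 2 ≤ |p 0 - slabCtr i|) :
    P.core p = P.ladder p - P.coreLevel := by
  unfold core coreFun ladder; rw [slabBump_eq_zero h]; ring

/-- Near a critical point of the ladder the core is the shifted ladder. [folklore] -/
theorem core_eventuallyEq_of_isMCriticalPt {p : 𝔼 2} (hp : IsMCriticalPt (𝓡 2) P.ladder p) :
    P.core =ᶠ[𝓝 p] fun q => P.ladder q - P.coreLevel := by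
  -- the strict inequality `1/2 < |p 0 - slabCtr i|` holds at the critical points
  have hstrict : ∀ i, 1 / 2 < |p 0 - slabCtr i| := by
    intro i
    have hi0 : (0 : ℝ) ≤ i := Nat.cast_nonneg i
    rcases (P.isMCriticalPt_iff_mem p).1 hp with h | ⟨j, -, h | h⟩
    · rw [h, pt_apply_zero]; unfold slabCtr
      rw [abs_of_neg (by linarith [P.t₀_pos])]; linarith [P.t₀_pos]
    all_goals
      rw [h, pt_apply_zero]
      unfold ctr slabCtr
    · have hξ := abs_lt.1 P.abs_x₁_lt
      rcases lt_or_ge j i with hji | hji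
      · have : (j : ℝ) + 1 ≤ i := by exact_mod_cast hji
        rw [abs_of_neg (by linarith)]; linarith
      · have : (i : ℝ) ≤ j := by exact_mod_cast hji
        rw [abs_of_pos (by linarith)]; linarith
    · have hξ := abs_lt.1 P.abs_x₂_lt
      rcases lt_or_ge j i with hji | hji
      · have : (j : ℝ) + 1 ≤ i := by exact_mod_cast hji
        rw [abs_of_neg (by linarith)]; linarith
      · have : (i : ℝ) ≤ j := by exact_mod_cast hji
        rw [abs_of_pos (by linarith)]; linarith
  set S : Set (𝔼 2) := ⋂ i ∈ Finset.range k, {q : 𝔼 2 | 1 / 2 < |q 0 - slabCtr i|} with hS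
  have hc0 : Continuous fun q : 𝔼 2 => q 0 := (EuclideanSpace.proj (0 : Fin 2)).continuous
  have hSo : IsOpen S := isOpen_biInter_finset fun i _ =>
    isOpen_lt continuous_const (hc0.sub continuous_const).abs
  have hpS : p ∈ S := mem_iInter₂.2 fun i _ => hstrict i
  exact eventuallyEq_of_mem (hSo.mem_nhds hpS) fun q hq =>
    P.core_eq_ladder_of_off fun i hi => (mem_iInter₂.1 hq i (Finset.mem_range.2 hi)).le

/-- At a critical point of the ladder the Hessians of core and ladder agree. [folklore] -/
theorem mhessian_core_eq_of_isMCriticalPt {p : 𝔼 2} (hp : IsMCriticalPt (𝓡 2) P.ladder p) :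
    mhessian (𝓡 2) P.core p = mhessian (𝓡 2) P.ladder p := by
  rw [mhessian_eq_of_eventuallyEq (P.core_eventuallyEq_of_isMCriticalPt hp)]
  ext v w
  rw [MorseBirth.mhessian_model_apply, MorseBirth.mhessian_model_apply]
  have : fderiv ℝ (fun q => P.ladder q - P.coreLevel) = fderiv ℝ P.ladder := by
    funext q; exact fderiv_sub_const _
  rw [this]

/-- At a critical point of the ladder the Morse indices of core and ladder agree. [folklore] -/
theorem morseIndex_core_eq_of_isMCriticalPt {p : 𝔼 2} (hp : IsMCriticalPt (𝓡 2) P.ladder p) :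
    morseIndex (𝓡 2) P.core p = morseIndex (𝓡 2) P.ladder p := by
  unfold morseIndex; rw [P.mhessian_core_eq_of_isMCriticalPt hp]

/-- **The core is a Morse function.** [folklore] -/
theorem isMorse_core : IsMorse (𝓡 2) P.core := by
  refine ⟨contMDiff_iff_contDiff.2 P.contDiff_core, fun p hp => ?_⟩
  rcases (P.isMCriticalPt_core_iff_mem p).1 hp with h | ⟨i, hi, z, hz, y, hy, rfl⟩
  · rw [P.mhessian_core_eq_of_isMCriticalPt h]; exact P.isMorse.2 p h
  · rcases hz with rfl | rfl <;> rcases hy with rfl | rfl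
    · exact (P.index_axis₁ hi).1
    · exact (P.index_pocket hi).1
    · exact (P.index_axis₂ hi).1
    · exact (P.index_cutSaddle hi).1

/-! ### §5 Values at the critical points; the level `0` -/

omit P in
/-- `b(0) = e⁻¹ < 3/8`. [folklore] -/
theorem bump_zero_lt : bump 0 < 3 / 8 := by
  rw [bump_zero]
  have h := Real.exp_one_gt_d9
  rw [Real.exp_neg, inv_lt_comm₀ (Real.exp_pos 1) (by norm_num)]
  linarith

omit P in
/-- `b(x⋆) < 1/10` (`b(x⋆) = e^{-1/(1 - 1/√3)} < e^{-7/3} < 1/10`). [folklore] -/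
theorem bump_xStar_lt : bump xStar < 1 / 10 := by
  have hx1 := xStar_lt_one
  have hx0 := xStar_pos
  have hsq : xStar ^ 2 = (Real.sqrt 3)⁻¹ := xStar_sq
  have h3 : Real.sqrt 3 < 7 / 4 := by
    rw [Real.sqrt_lt' (by norm_num)]; norm_num
  have h3pos : 0 < Real.sqrt 3 := Real.sqrt_pos.2 (by norm_num)
  have hinv : 4 / 7 < (Real.sqrt 3)⁻¹ := by
    rw [div_lt_iff₀ (by norm_num : (0:ℝ) < 7), ← div_eq_inv_mul] at *
    · rw [lt_div_iff₀ h3pos]; linarith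
  have e : bump xStar = Real.exp (-(1 - xStar ^ 2)⁻¹) := by
    simp only [bump, expNegInvGlue]
    rw [if_neg (by nlinarith)]
  rw [e, Real.exp_neg, inv_lt_comm₀ (Real.exp_pos _) (by norm_num)]
  -- `10 < exp ((1 - x⋆²)⁻¹)` since `(1 - x⋆²)⁻¹ > 7/3` and `exp (7/3) > 10`
  have hgt : 7 / 3 < (1 - xStar ^ 2)⁻¹ := by
    rw [hsq, lt_inv_comm₀ (by norm_num) (by nlinarith)]
    linarith
  have hexp : (10 : ℝ) < Real.exp (7 / 3) := by
    have h1 : Real.exp (7 / 3) = Real.exp 1 * Real.exp 1 * Real.exp (1 / 3) := by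
      rw [← Real.exp_add, ← Real.exp_add]; norm_num
    have h2 := Real.exp_one_gt_d9
    have h4 : 1 + 1 / 3 + (1 / 3) ^ 2 / 2 ≤ Real.exp (1 / 3) := Real.quadratic_le_exp_of_nonneg (by norm_num)
    rw [h1]
    nlinarith [Real.exp_pos 1, mul_pos (Real.exp_pos 1) (Real.exp_pos 1)]
  simpa using hexp.trans (Real.exp_lt_exp.2 hgt)

/-- **The ladder level exceeds `2/5`.** [folklore] -/
theorem level_gt' : 2 / 5 < P.level := by
  unfold level
  have h1 : bump P.x₁ < bump xStar := by
    have h := P.x₁_mem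
    exact bump_lt_bump (by rw [abs_of_pos xStar_pos, abs_of_neg (by linarith [h.2, xStar_pos])]; linarith [h.2])
      (by rw [abs_of_pos xStar_pos]; exact xStar_lt_one)
  have h2 := bump_le_bump_zero P.x₂
  have h3 := P.κ_smoothAbs_zero_mem.2
  linarith [bump_xStar_lt, bump_zero_lt]

omit P in
/-- `Δ⋆ < 3/8`. [folklore] -/
theorem gapStar_lt_three_eighths : gapStar < 3 / 8 := by
  unfold gapStar; linarith [bump_le_bump_zero (1 / 2), bump_nonneg xStar, bump_zero_lt]

/-- **Bounds for the core level**: `3/10 < c' < c`. [folklore] -/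
theorem coreLevel_gt : 3 / 10 < P.coreLevel := by
  unfold coreLevel; linarith [P.level_gt', gapStar_lt_three_eighths]

/-- `c' < c`. [folklore] -/
theorem coreLevel_lt_level : P.coreLevel < P.level := by
  unfold coreLevel; linarith [gapStar_pos]

/-- `c' < 1`. [folklore] -/
theorem coreLevel_lt_one : P.coreLevel < 1 := by
  linarith [P.coreLevel_lt_level, P.level_lt, P.κ_pos]

/-- `τ ≤ 1/16`. [folklore] -/
theorem τ_le : P.τ ≤ 1 / 16 := by
  have h := P.τ_mul_xR_le
  have hk : (0 : ℝ) ≤ k := Nat.cast_nonneg k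
  have h1 : 1 ≤ xR k := by unfold xR; linarith
  nlinarith [P.τ_pos]

omit P in
/-- `1/4 < b(1/2)`. [folklore] -/
theorem quarter_lt_bump_half : 1 / 4 < bump (1 / 2) := by
  have e : bump (1 / 2) = Real.exp (-(4 / 3)) := by
    simp only [bump, expNegInvGlue]; norm_num
  rw [e, Real.exp_neg, lt_inv_comm₀ (by norm_num) (Real.exp_pos _)]
  have h1 : Real.exp (4 / 3) = Real.exp 1 * Real.exp (1 / 3) := by
    rw [← Real.exp_add]; norm_num
  have h2 := Real.exp_one_lt_d9
  have h3 : Real.exp (1 / 3) < 1.4 := by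
    have h5 := Real.exp_bound' (x := 1 / 3) (by norm_num) (by norm_num) (n := 3) (by norm_num)
    norm_num [Finset.sum_range_succ, Nat.factorial] at h5
    linarith
  rw [h1]
  nlinarith [Real.exp_pos 1, Real.exp_pos (1 / 3)]

/-- **The saddle values lie below the core level** (with room `Δ⋆/4`). [folklore] -/
theorem ladderFun_saddle_lt_coreLevel {i : ℕ} (hi : i < k) : P.ladderFun (ctr i + P.x₂) 0 < P.coreLevel := by
  rw [P.ladderFun_cell hi P.abs_x₂_lt]
  unfold coreLevel level
  obtain ⟨-, h2, -⟩ := ctr_add_mem hi P.abs_x₂_lt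
  have hτ := P.τ_pos
  have hg := P.gapStar_lt
  have hs := P.τ_small
  have : P.τ * (ctr i + P.x₂) < P.τ * xR k := by gcongr
  have : min gapStar (1 / 8) / 2 ≤ gapStar / 2 := by gcongr; exact min_le_left _ _
  have hg0 := gapStar_pos
  unfold xR at *
  linarith

/-- `4 b(z₁) ≤ τ/2` (`b = b' (1 - z²)²/(2|z|)` with `b'(z₁) = τ/8`, `|z₁| > x⋆ > 1/2`). [folklore] -/
theorem four_bump_z₁_le : 4 * bump P.z₁ ≤ P.τ / 2 := by
  have hz := P.z₁_mem
  have hz1 : |P.z₁| < 1 := P.abs_z₁_lt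
  have hd := dbump_eq hz1
  rw [P.dbump_z₁] at hd
  have hneg : P.z₁ < 0 := by linarith [hz.2, xStar_pos]
  have h1 : 0 < 1 - P.z₁ ^ 2 := by nlinarith [abs_lt.1 hz1]
  have h2 : (1 - P.z₁ ^ 2) ^ 2 ≤ 1 := by nlinarith
  have hb := bump_nonneg P.z₁
  -- `τ/8 = -2 z₁ (1 - z₁²)⁻² b(z₁)`, i.e. `b(z₁) (2|z₁|) = (τ/8) (1 - z₁²)²`
  have key : bump P.z₁ * (2 * -P.z₁) = P.τ / 8 * (1 - P.z₁ ^ 2) ^ 2 := by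
    rw [hd]; field_simp
  have hx : 1 < 2 * -P.z₁ := by linarith [hz.2, half_lt_xStar]
  nlinarith [P.τ_pos]

/-- **The pocket values are negative.** [folklore] -/
theorem core_pocket_lt {i : ℕ} (hi : i < k) : P.core (pt (slabCtr i - P.z₁ / 2) 1) < 0 := by
  have hκ4 := P.κ_le
  have hx := abs_cut_sub_slabCtr P.abs_z₁_lt i
  rw [P.core_eq_upper hi (by simpa using hx) (by simp only [pt_apply_one]; exact ⟨by linarith, by norm_num⟩)]
  simp only [pt_apply_zero, pt_apply_one, xProfile, show 2 * (slabCtr i - P.z₁ / 2 - slabCtr i) = -P.z₁ by ring,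
    bump_neg]
  obtain ⟨-, h2, -⟩ := slab_mem hi hx
  have h4 := P.four_bump_z₁_le
  have hτ := P.τ_pos
  have hτ1 := P.τ_le
  have hc := P.coreLevel_gt
  have : P.τ * (slabCtr i - P.z₁ / 2) < P.τ * xR k := by gcongr
  have := P.τ_mul_xR_le
  nlinarith

/-- **The cut saddle values are positive.** [folklore] -/
theorem core_cutSaddle_pos {i : ℕ} (hi : i < k) : 0 < P.core (pt (slabCtr i - P.z₂ / 2) 1) := by
  have hκ4 := P.κ_le
  have hx := abs_cut_sub_slabCtr P.abs_z₂_lt i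
  rw [P.core_eq_upper hi (by simpa using hx) (by simp only [pt_apply_one]; exact ⟨by linarith, by norm_num⟩)]
  simp only [pt_apply_zero, pt_apply_one, xProfile, show 2 * (slabCtr i - P.z₂ / 2 - slabCtr i) = -P.z₂ by ring,
    bump_neg]
  obtain ⟨h1, -, -⟩ := slab_mem hi hx
  have hz := P.z₂_mem
  have hb : bump (1 / 2) < bump P.z₂ :=
    bump_lt_bump (by rw [abs_of_neg hz.2, abs_of_pos (by norm_num : (0:ℝ) < 1 / 2)]; linarith [hz.1])
      (by rw [abs_of_neg hz.2]; linarith [hz.1])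
  have hq := quarter_lt_bump_half
  have hc := P.coreLevel_lt_one
  have hτ := P.τ_pos
  nlinarith

/-- **The axis values are positive.** [folklore] -/
theorem core_axis_pos {i : ℕ} (hi : i < k) {z : ℝ} (hz : |z| < 1) : 0 < P.core (pt (slabCtr i - z / 2) 0) := by
  have hx := abs_cut_sub_slabCtr hz i
  rw [P.core_eq_axis hi (by simpa using hx) (by simp only [pt_apply_one, abs_zero]; norm_num)]
  simp only [pt_apply_zero, pt_apply_one, xProfile, yProfile₀]
  obtain ⟨h1, -, -⟩ := slab_mem hi hx
  have hc : P.coreLevel < 1 - (bump P.x₁ + bump P.x₂) - P.κ / 2 * smoothAbs 0 := P.coreLevel_lt_level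
  have hb := bump_nonneg (2 * (slabCtr i - z / 2 - slabCtr i))
  have hb1 := bump_nonneg P.x₁
  have hb2 := bump_nonneg P.x₂
  have hτ := P.τ_pos
  simp only [mul_zero, zero_div, ne_eq, OfNat.ofNat_ne_zero, not_false_eq_true, zero_pow]
  nlinarith

/-- The cap value is negative. [folklore] -/
theorem core_cap_lt : P.core (pt (-P.t₀) 0) < 0 := by
  have hoff := P.half_le_abs_sub_slabCtr_of_isMCriticalPt ((P.isMCriticalPt_iff_mem _).2 (Or.inl rfl))
  rw [P.core_eq_ladder_of_off fun i _ => hoff i, ladder_pt]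
  have h1 := P.ladderFun_cap_le
  have h2 := P.coreLevel_gt
  have h3 := P.κ_smoothAbs_zero_mem.1
  linarith

/-- The rung saddle values are negative. [folklore] -/
theorem core_saddle_lt {i : ℕ} (hi : i < k) : P.core (pt (ctr i + P.x₂) 0) < 0 := by
  have hoff := P.half_le_abs_sub_slabCtr_of_isMCriticalPt
    ((P.isMCriticalPt_iff_mem _).2 (Or.inr ⟨i, hi, Or.inr rfl⟩))
  rw [P.core_eq_ladder_of_off fun i _ => hoff i, ladder_pt]
  linarith [P.ladderFun_saddle_lt_coreLevel hi]

/-- The hole maximum values are positive. [folklore] -/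
theorem core_max_pos {i : ℕ} (hi : i < k) : 0 < P.core (pt (ctr i + P.x₁) 0) := by
  have hoff := P.half_le_abs_sub_slabCtr_of_isMCriticalPt
    ((P.isMCriticalPt_iff_mem _).2 (Or.inr ⟨i, hi, Or.inl rfl⟩))
  rw [P.core_eq_ladder_of_off fun i _ => hoff i, ladder_pt]
  linarith [P.level_lt_ladderFun_max hi, P.coreLevel_lt_level]

/-! ### §6 The classification of the critical points of the core: index and sign of the value -/

/-- **Every critical point of the core is one of seven kinds**, with its index and the sign of its
value. [folklore] -/
theorem crit_core_cases {p : 𝔼 2} (hp : IsMCriticalPt (𝓡 2) P.core p) :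
    (p = pt (-P.t₀) 0 ∧ morseIndex (𝓡 2) P.core p = 0 ∧ P.core p < 0) ∨
    (∃ i < k, p = pt (ctr i + P.x₁) 0 ∧ morseIndex (𝓡 2) P.core p = 2 ∧ 0 < P.core p) ∨
    (∃ i < k, p = pt (ctr i + P.x₂) 0 ∧ morseIndex (𝓡 2) P.core p = 1 ∧ P.core p < 0) ∨
    (∃ i < k, p = pt (slabCtr i - P.z₁ / 2) 1 ∧ morseIndex (𝓡 2) P.core p = 0 ∧ P.core p < 0) ∨
    (∃ i < k, p = pt (slabCtr i - P.z₂ / 2) 1 ∧ morseIndex (𝓡 2) P.core p = 1 ∧ 0 < P.core p) ∨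
    (∃ i < k, p = pt (slabCtr i - P.z₁ / 2) 0 ∧ morseIndex (𝓡 2) P.core p = 1 ∧ 0 < P.core p) ∨
    (∃ i < k, p = pt (slabCtr i - P.z₂ / 2) 0 ∧ morseIndex (𝓡 2) P.core p = 2 ∧ 0 < P.core p) := by
  rcases (P.isMCriticalPt_core_iff_mem p).1 hp with h | ⟨i, hi, z, hz, y, hy, rfl⟩
  · have hidx := P.morseIndex_core_eq_of_isMCriticalPt h
    rcases (P.isMCriticalPt_iff_mem p).1 h with rfl | ⟨i, hi, rfl | rfl⟩
    · exact Or.inl ⟨rfl, by rw [hidx, P.morseIndex_min], P.core_cap_lt⟩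
    · exact Or.inr (Or.inl ⟨i, hi, rfl, by rw [hidx, P.morseIndex_max hi], P.core_max_pos hi⟩)
    · exact Or.inr (Or.inr (Or.inl ⟨i, hi, rfl, by rw [hidx, P.morseIndex_saddle hi], P.core_saddle_lt hi⟩))
  · rcases hz with rfl | rfl <;> rcases hy with rfl | rfl
    · exact Or.inr (Or.inr (Or.inr (Or.inr (Or.inr (Or.inl ⟨i, hi, rfl, (P.index_axis₁ hi).2,
        P.core_axis_pos hi P.abs_z₁_lt⟩)))))
    · exact Or.inr (Or.inr (Or.inr (Or.inl ⟨i, hi, rfl, (P.index_pocket hi).2, P.core_pocket_lt hi⟩)))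
    · exact Or.inr (Or.inr (Or.inr (Or.inr (Or.inr (Or.inr ⟨i, hi, rfl, (P.index_axis₂ hi).2,
        P.core_axis_pos hi P.abs_z₂_lt⟩)))))
    · exact Or.inr (Or.inr (Or.inr (Or.inr (Or.inl ⟨i, hi, rfl, (P.index_cutSaddle hi).2,
        P.core_cutSaddle_pos hi⟩))))

/-- **No critical value of the core is `0`.** [folklore] -/
theorem core_ne_zero_of_isMCriticalPt {p : 𝔼 2} (hp : IsMCriticalPt (𝓡 2) P.core p) : P.core p ≠ 0 := by
  rcases P.crit_core_cases hp with ⟨-, -, h⟩ | ⟨_, _, -, -, h⟩ | ⟨_, _, -, -, h⟩ | ⟨_, _, -, -, h⟩ |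
    ⟨_, _, -, -, h⟩ | ⟨_, _, -, -, h⟩ | ⟨_, _, -, -, h⟩
  all_goals first | exact h.ne | exact h.ne'

/-- The maxima of the core lie above `0`. [folklore] -/
theorem core_pos_of_index_two {p : 𝔼 2} (hp : p ∈ criticalSetOfIndex (𝓡 2) P.core 2) : 0 < P.core p := by
  obtain ⟨hc, hidx⟩ := hp
  rcases P.crit_core_cases hc with ⟨-, h, -⟩ | ⟨_, _, -, -, h⟩ | ⟨_, _, -, h, -⟩ | ⟨_, _, -, h, -⟩ |
    ⟨_, _, -, h, -⟩ | ⟨_, _, -, h, -⟩ | ⟨_, _, -, -, h⟩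
  all_goals first | exact h | (rw [hidx] at h; norm_num at h)

/-- The pockets are critical of index `0` with negative value, and the cap too: the index-`0`
critical set below `0`. [folklore] -/
theorem criticalSetOfIndex_core_zero_inter :
    criticalSetOfIndex (𝓡 2) P.core 0 ∩ P.core ⁻¹' Iic 0 =
      {pt (-P.t₀) 0} ∪ (fun i : ℕ => pt (slabCtr i - P.z₁ / 2) 1) '' (Finset.range k : Set ℕ) := by
  ext p
  simp only [mem_inter_iff, mem_criticalSetOfIndex, mem_preimage, mem_Iic, mem_union, mem_singleton_iff,
    mem_image, Finset.coe_range, mem_Iio]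
  constructor
  · rintro ⟨⟨hc, hidx⟩, hle⟩
    rcases P.crit_core_cases hc with ⟨h, -, -⟩ | ⟨_, _, -, h, -⟩ | ⟨_, _, -, h, -⟩ | ⟨i, hi, h, -, -⟩ |
      ⟨_, _, -, h, -⟩ | ⟨_, _, -, h, -⟩ | ⟨_, _, -, h, -⟩
    · exact Or.inl h
    all_goals first | exact Or.inr ⟨i, hi, h.symm⟩ | (rw [hidx] at h; norm_num at h)
  · rintro (rfl | ⟨i, hi, rfl⟩)
    · have hc : IsMCriticalPt (𝓡 2) P.core (pt (-P.t₀) 0) :=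
        (P.isMCriticalPt_core_iff_mem _).2 (Or.inl ((P.isMCriticalPt_iff_mem _).2 (Or.inl rfl)))
      refine ⟨⟨hc, ?_⟩, P.core_cap_lt.le⟩
      rw [P.morseIndex_core_eq_of_isMCriticalPt ((P.isMCriticalPt_iff_mem _).2 (Or.inl rfl)), P.morseIndex_min]
    · have hc : IsMCriticalPt (𝓡 2) P.core (pt (slabCtr i - P.z₁ / 2) 1) :=
        (P.isMCriticalPt_core_iff_mem _).2 (Or.inr ⟨i, hi, P.z₁, by simp, 1, by simp, rfl⟩)
      exact ⟨⟨hc, (P.index_pocket hi).2⟩, (P.core_pocket_lt hi).le⟩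

/-- The index-`1` critical set below `0`: the rung saddles. [folklore] -/
theorem criticalSetOfIndex_core_one_inter :
    criticalSetOfIndex (𝓡 2) P.core 1 ∩ P.core ⁻¹' Iic 0 =
      (fun i : ℕ => pt (ctr i + P.x₂) 0) '' (Finset.range k : Set ℕ) := by
  ext p
  simp only [mem_inter_iff, mem_criticalSetOfIndex, mem_preimage, mem_Iic, mem_image, Finset.coe_range, mem_Iio]
  constructor
  · rintro ⟨⟨hc, hidx⟩, hle⟩
    rcases P.crit_core_cases hc with ⟨-, h, -⟩ | ⟨_, _, -, h, -⟩ | ⟨i, hi, h, -, -⟩ | ⟨_, _, -, h, -⟩ |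
      ⟨_, _, -, -, h⟩ | ⟨_, _, -, -, h⟩ | ⟨_, _, -, h, -⟩
    all_goals first | exact ⟨i, hi, h.symm⟩ | (rw [hidx] at h; norm_num at h) | exact absurd hle (not_le.2 h)
  · rintro ⟨i, hi, rfl⟩
    have hl : IsMCriticalPt (𝓡 2) P.ladder (pt (ctr i + P.x₂) 0) :=
      (P.isMCriticalPt_iff_mem _).2 (Or.inr ⟨i, hi, Or.inr rfl⟩)
    have hc : IsMCriticalPt (𝓡 2) P.core (pt (ctr i + P.x₂) 0) := (P.isMCriticalPt_core_iff_mem _).2 (Or.inl hl)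
    refine ⟨⟨hc, ?_⟩, (P.core_saddle_lt hi).le⟩
    rw [P.morseIndex_core_eq_of_isMCriticalPt hl, P.morseIndex_saddle hi]

omit P in
/-- Distinct slabs give distinct pocket points. [folklore] -/
theorem slab_pt_injective (z y : ℝ) : Function.Injective fun i : ℕ => pt (slabCtr i - z / 2) y := by
  intro i j h
  have := congrArg (fun p : 𝔼 2 => p 0) h
  simp only [pt_apply_zero, slabCtr] at this
  exact_mod_cast (by linarith : (i : ℝ) = j)

/-- **Exactly `k + 1` critical points of index `0` below `0`.** [folklore] -/
theorem ncard_criticalSetOfIndex_core_zero_inter :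
    (criticalSetOfIndex (𝓡 2) P.core 0 ∩ P.core ⁻¹' Iic 0).ncard = k + 1 := by
  rw [criticalSetOfIndex_core_zero_inter]
  have hdisj : Disjoint ({pt (-P.t₀) 0} : Set (𝔼 2))
      ((fun i : ℕ => pt (slabCtr i - P.z₁ / 2) 1) '' (Finset.range k : Set ℕ)) := by
    rw [Set.disjoint_singleton_left]
    rintro ⟨i, -, h⟩
    have := congrArg (fun p : 𝔼 2 => p 1) h
    simp at this
  rw [Set.ncard_union_eq hdisj (Set.finite_singleton _) ((Finset.finite_toSet _).image _), Set.ncard_singleton,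
    Set.ncard_image_of_injective _ (slab_pt_injective _ _), Set.ncard_coe_finset, Finset.card_range]
  ring

/-- **Exactly `k` critical points of index `1` below `0`.** [folklore] -/
theorem ncard_criticalSetOfIndex_core_one_inter :
    (criticalSetOfIndex (𝓡 2) P.core 1 ∩ P.core ⁻¹' Iic 0).ncard = k := by
  rw [criticalSetOfIndex_core_one_inter, Set.ncard_image_of_injective _ (ctr_add_injective _), Set.ncard_coe_finset,
    Finset.card_range]

/-- **The critical set of the core is finite.** [folklore] -/
theorem finite_criticalSet_core : (criticalSet (𝓡 2) P.core).Finite := by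
  have hsub : criticalSet (𝓡 2) P.core ⊆ criticalSet (𝓡 2) P.ladder ∪
      ⋃ i ∈ Finset.range k, {pt (slabCtr i - P.z₁ / 2) 0, pt (slabCtr i - P.z₁ / 2) 1,
        pt (slabCtr i - P.z₂ / 2) 0, pt (slabCtr i - P.z₂ / 2) 1} := by
    intro p hp
    rcases (P.isMCriticalPt_core_iff_mem p).1 hp with h | ⟨i, hi, z, hz, y, hy, rfl⟩
    · exact Or.inl h
    · refine Or.inr (mem_iUnion₂.2 ⟨i, Finset.mem_range.2 hi, ?_⟩)
      rcases hz with rfl | rfl <;> rcases hy with rfl | rfl <;> simp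
  refine Set.Finite.subset (P.finite_criticalSet.union ?_) hsub
  exact (Finset.finite_toSet _).biUnion fun i _ => by
    exact (((Set.finite_singleton _).insert _).insert _).insert _

/-- **Coercivity of the core.** [folklore] -/
theorem norm_sq_le_core (u : 𝔼 2) : ‖u‖ ^ 2 ≤ P.core u + (P.coreLevel + (3 / 2 * (xR k + 1) ^ 2 + 12)) := by
  have h1 := P.norm_sq_le u
  have h2 : P.ladder u - P.coreLevel ≤ P.core u := by
    unfold core coreFun ladder
    have := mul_nonneg (mul_nonneg (by norm_num : (0:ℝ) ≤ 4) (cutoffY_nonneg (u 1))) (slabBump_nonneg k (u 0))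
    linarith
  linarith

/-- **`0` is a regular level of the core** in the strong sense: the core has no critical point on
it. [folklore] -/
theorem isRegularLevel_core : IsRegularLevel (𝓡 2) P.core 0 :=
  P.isMorse_core.isRegularLevel fun _ hp => P.core_ne_zero_of_isMCriticalPt hp

end Params

end Ladder

end Literature.Topology.FourManifolds
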